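import Mathlib
import Summits.ResolutionOfSingularities.ResolutionOfSingularities.Theorems.WeightedInvariantDatumToEmbeddedAtlasDefs
import Summits.ResolutionOfSingularities.ResolutionOfSingularities.Theorems.WeightedInvariantDatumToEmbeddedAtlasQuotientLocal
import Summits.ResolutionOfSingularities.ResolutionOfSingularities.Theorems.WeightedInvariantDatumToEmbeddedAtlasQuotientChart
import Summits.ResolutionOfSingularities.ResolutionOfSingularities.Theorems.WeightedInvariantDatumToEmbeddedAtlasQuotientRing
import Summits.ResolutionOfSingularities.ResolutionOfSingularities.Theorems.WeightedInvariantDatumToEmbeddedLift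
import Literature.AlgebraicGeometry.Resolution.WeightedResolutionDatum
import Literature.AlgebraicGeometry.Resolution.CobordantBlowupGlobal
import Literature.AlgebraicGeometry.Resolution.Blowups
import Literature.AlgebraicGeometry.Resolution.BlowupPrincipalCharts
import HarnessLib

/-!
# The quotient chart under an ambient chart, IV: injectivity of `q'♯` and assembly

Topic: `Summits/ResolutionOfSingularities/ResolutionOfSingularities/Theorems`. Stub
`stub_qs_atlas_quotient` of the line `Sketch` of the crux `Theses.WeightedInvariant.DatumToEmbedded`
(statement `stmt-ResolutionOfSingularities-0572`) of the summit
`Summit.ResolutionOfSingularities.ResolutionOfSingularities`, in the CORRECTED form carrying the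
hypothesis `β ∈ J_{Dg}(W a)` (J. Włodarczyk, arXiv:2203.03090, §2.3.3: the quotient `B₊⫽𝔾ₘ` of
the cobordant blow-up is the blow-up downstairs; Stacks 0804).

* `app_blowupChart_injective` — (Q4) `q'♯ : Γ(V', V'[U a, b]) → Γ(X', q'⁻¹ V'[U a, b])` is
  injective: if `q'♯c' = 0` write `c' · ρ♯b^l = ρ♯c` with `c ∈ K(U a)^l` (Q3); lift `c` to a
  degree-`0` section `s` of `W a` (`𝒜.exists_lift`); along (Q1) `i'♯(π♯s)` is `q'♯(ρ♯c) = 0`, so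
  `π♯s` lies in the ideal of the strict transform on `𝒞.W'`, the contraction property gives
  `s β ∈ I(W a)`, hence `q♯(c b) = i♯(s β) = 0`, `c b = 0` (`𝒜.appLE_injective`), so
  `ρ♯c · ρ♯b = 0`, `ρ♯c = 0` and `c' = 0` (`ρ♯b` is a non-zero-divisor, (Q2));
* `stub_qs_atlasQuotientOf` — the registered form: (Q1) ∧ (Q2) ∧ (Q3) ∧ (Q3') ∧ (Q4) for the
  datum's downstairs centre `K = ker (V(J_{Dg}|_X) ⟶ V)`, with `t⁻¹ ≢ 0` on `X'` supplied by
  `Lift.nonempty_preimage_basicOpen`.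

All proofs are glue on Mathlib and the tree; no definitions, no named facts.
-/

noncomputable section

open CategoryTheory CategoryTheory.Limits AlgebraicGeometry TopologicalSpace
open Literature.AlgebraicGeometry.Resolution

set_option linter.dupNamespace false -- mandated namespace `…Theorems.DatumToEmbedded.<Topic>`

namespace Summit.ResolutionOfSingularities.ResolutionOfSingularities.Theorems.DatumToEmbedded.AtlasQuotient

/-! ## (Q4): `q'♯` is injective on the principal chart -/

section Injective

variable {k : Type} [Field k] {Y X V : Scheme.{0}} (f : Y ⟶ Spec (.of k))
  (i : X ⟶ Y) [IsClosedImmersion i] (q : X ⟶ V) {j : ℕ} (𝒜 : GradedAtlas j f i q)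
  (J : ℕ → Y.IdealSheafData) (R' : ReesFiltration Y)
  (σX : (R'.strictTransformPlus i.ker).subscheme ⟶ X)
  (hσX : σX ≫ i = (R'.strictTransformPlus i.ker).subschemeι ≫ R'.πPlus)
  (Dg : ℕ) (K : V.IdealSheafData) {V' : Scheme.{0}} (ρ : V' ⟶ V) (hρ : IsBlowup ρ K)
  (q' : (R'.strictTransformPlus i.ker).subscheme ⟶ V') (hq' : q' ≫ ρ = σX ≫ q) (a : 𝒜.ι)
  {b : Γ(V, 𝒜.U a)} (hb : b ∈ K.ideal (𝒜.U a)) {β : Γ(Y, 𝒜.W a)}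
  (hβ : i.app (𝒜.W a) β = q.appLE (𝒜.U a) (i ⁻¹ᵁ (𝒜.W a)) (𝒜.preimage_eq a).le b)
  (𝒞 : AmbientChart j f i q 𝒜 J R' Dg a β)
  (hcontr : ∀ x : Γ(Y, 𝒜.W a), R'.πPlus.appLE (𝒜.W a) 𝒞.W' 𝒞.le_preimage x ∈
    (R'.strictTransformPlus i.ker).ideal 𝒞.W' → x * β ∈ i.ker.ideal (𝒜.W a))
  (hQ1 : (R'.strictTransformPlus i.ker).subschemeι ⁻¹ᵁ (𝒞.W' : (R'.plus : Scheme.{0}).Opens) =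
    q' ⁻¹ᵁ blowupChart ρ K (𝒜.U a) b)

include hσX hρ hq' hb hβ hcontr hQ1 in
/-- **(Q4) `q'♯` is injective on the principal chart `V'[U a, b]`** (given (Q1) and the
contraction property of the ambient chart; see the module docstring). [cite: Wlodarczyk2022, §2.3.3] -/
theorem app_blowupChart_injective :
    Function.Injective (q'.app (blowupChart ρ K (𝒜.U a) b)) := by
  have hU'le := blowupChart_le_preimage ρ K (𝒜.U a) b
  have hnzd := appLE_blowupChart_mem_nonZeroDivisors hρ hb
  rw [injective_iff_map_eq_zero]
  intro c' hc'
  obtain ⟨l, c, -, hcc'⟩ := exists_of_section_blowupChart hρ hb c'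
  -- `q'♯(ρ♯c) = q'♯c' · q'♯(ρ♯b)^l = 0`
  have h1 : q'.app (blowupChart ρ K (𝒜.U a) b) (ρ.appLE (𝒜.U a) _ hU'le c) = 0 := by
    rw [← hcc', map_mul, hc', zero_mul]
  -- lift `c` to a degree-`0` section `s` of `W a`; along (Q1), `q'♯(ρ♯c) = i'♯(π♯s)|`
  obtain ⟨s, -, hs⟩ := 𝒜.exists_lift a c
  have hle : q' ⁻¹ᵁ blowupChart ρ K (𝒜.U a) b ≤
      (R'.strictTransformPlus i.ker).subschemeι ⁻¹ᵁ (𝒞.W' : (R'.plus : Scheme.{0}).Opens) := hQ1.ge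
  have h2 : q'.app (blowupChart ρ K (𝒜.U a) b) (ρ.appLE (𝒜.U a) _ hU'le c) =
      (R'.strictTransformPlus i.ker).subschemeι.appLE 𝒞.W' _ hle
        (R'.πPlus.appLE (𝒜.W a) 𝒞.W' 𝒞.le_preimage s) := by
    rw [Scheme.Hom.app_eq_appLE]
    exact appLE_appLE_eq f i q 𝒜 R' σX hσX ρ q' hq' a c s hs.symm 𝒞.le_preimage hU'le le_rfl hle
  -- restriction along the EQUAL opens `i'⁻¹ W' = q'⁻¹ U'` is injective, so `i'♯(π♯s) = 0`
  have h3 : (R'.strictTransformPlus i.ker).subschemeι.app 𝒞.W'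
      (R'.πPlus.appLE (𝒜.W a) 𝒞.W' 𝒞.le_preimage s) = 0 := by
    have key : ∀ (O : (R'.strictTransformPlus i.ker).subscheme.Opens)
        (hO : O = (R'.strictTransformPlus i.ker).subschemeι ⁻¹ᵁ (𝒞.W' : (R'.plus : Scheme.{0}).Opens))
        (h : O ≤ (R'.strictTransformPlus i.ker).subschemeι ⁻¹ᵁ (𝒞.W' : (R'.plus : Scheme.{0}).Opens))
        (x : Γ((R'.plus : Scheme.{0}), 𝒞.W')),
        (R'.strictTransformPlus i.ker).subschemeι.appLE 𝒞.W' O h x = 0 →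
          (R'.strictTransformPlus i.ker).subschemeι.app 𝒞.W' x = 0 := by
      intro O hO h x hx
      subst hO
      rwa [Scheme.Hom.appLE_eq_app] at hx
    exact key _ hQ1.symm hle _ (h2 ▸ h1)
  -- so `π♯s` is in the ideal of the strict transform, and `s β ∈ I(W a)` by contraction
  have h4 : R'.πPlus.appLE (𝒜.W a) 𝒞.W' 𝒞.le_preimage s ∈
      (R'.strictTransformPlus i.ker).ideal 𝒞.W' := by
    rw [← Scheme.IdealSheafData.ker_subschemeι_app]
    exact h3
  have h5 : i.app (𝒜.W a) (s * β) = 0 := by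
    have h := hcontr s h4
    rw [Scheme.Hom.ker_apply] at h
    exact h
  -- hence `q♯(c b) = 0`, `c b = 0`, `ρ♯c = 0`, `c' = 0`
  have h6 : c * b = 0 := 𝒜.appLE_injective a (by rw [map_mul, hs, ← hβ, ← map_mul, h5, map_zero])
  have h7 : ρ.appLE (𝒜.U a) _ hU'le c = 0 :=
    (mem_nonZeroDivisors_iff_right.mp hnzd) _ (by rw [← map_mul, h6, map_zero])
  exact (mem_nonZeroDivisors_iff_right.mp (pow_mem hnzd l)) _ (by rw [hcc', h7])

end Injective

/-! ## Registered form (corrected signature of `stub_qs_atlas_quotient`) -/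

/-- **Registered sub-goal `stub_qs_atlasQuotientOf`** of the crux (helper of the stub
`stub_qs_atlas_quotient`, whose registered signature lacks the hypothesis `β ∈ J_{Dg}(W a)` needed
for the inclusion `q'⁻¹(V'[U a, b]) ⊆ X' ∩ 𝒞.W'`): **the quotient chart under an ambient chart.**
For `b ∈ K(U a)` with a lift `β ∈ J_{Dg}(W a)`, `i♯β = q♯b`, and an ambient chart `𝒞` at `(a, β)`
with the contraction property: (Q1) `X' ∩ 𝒞.W' = q'⁻¹(V'[U a, b])`; (Q2) `ρ♯b` is a
non-zero-divisor on the principal chart; (Q3)/(Q3') its sections are exactly the `ρ♯c/ρ♯b^l`,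
`c ∈ K(U a)^l`; (Q4) `q'♯` is injective on it. [cite: Wlodarczyk2022, §2.3.3] -/
theorem stub_qs_atlasQuotientOf :
    ∀ {p : ℕ} (D : WeightedResolutionDatum p) {k : Type} [Field k] [CharP k p] [PerfectField k] {Y X
      V : Scheme.{0}} (f : Y ⟶ Spec (.of k)) [Smooth f] [IsSeparated f] [QuasiCompact f] (i : X ⟶ Y)
      [IsClosedImmersion i] [IsIntegral X] (q : X ⟶ V) [IsIntegral V] (g : V ⟶ Spec (.of k))
      [IsSeparated g] [LocallyOfFiniteType g] [QuasiCompact g], q ≫ g = i ≫ f → ∀ {j : ℕ} (𝒜 :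
      GradedAtlas j f i q), (∃ y : Y, ¬ IsBot (D.inv f i.ker y)) → ∀ (R' : ReesFiltration Y), R'.ideal
      = (D.centre f i.ker).piece → ∀ [IsIntegral (R'.strictTransformPlus i.ker).subscheme] (σX :
      (R'.strictTransformPlus i.ker).subscheme ⟶ X), σX ≫ i = (R'.strictTransformPlus
      i.ker).subschemeι ≫ R'.πPlus → ∀ (Dg : ℕ), 0 < Dg → ((D.centre f i.ker).piece Dg).comap R'.πPlus
      = R'.excPlus ^ Dg → (((((D.centre f i.ker).piece Dg).comap i).subschemeι ≫ q).ker).comap (σX ≫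
      q) = (R'.excPlus.comap (R'.strictTransformPlus i.ker).subschemeι) ^ Dg → ∀ (V' : Scheme.{0}) (ρ
      : V' ⟶ V), IsBlowup ρ (((((D.centre f i.ker).piece Dg).comap i).subschemeι ≫ q).ker) → ∀
      [IsIntegral V'] (q' : (R'.strictTransformPlus i.ker).subscheme ⟶ V'), q' ≫ ρ = σX ≫ q → ∀ (a :
      𝒜.ι) (b : Γ(V, 𝒜.U a)), b ∈ (((((D.centre f i.ker).piece Dg).comap i).subschemeι ≫ q).ker).ideal
      (𝒜.U a) → ∀ (β : Γ(Y, 𝒜.W a)), β ∈ ((D.centre f i.ker).piece Dg).ideal (𝒜.W a) → i.app (𝒜.W a) β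
      = q.appLE (𝒜.U a) (i ⁻¹ᵁ (𝒜.W a)) (𝒜.preimage_eq a).le b → ∀ (𝒞 : AmbientChart j f i q 𝒜
      (D.centre f i.ker).piece R' Dg a β), (∀ x : Γ(Y, 𝒜.W a), R'.πPlus.appLE (𝒜.W a) 𝒞.W'
      𝒞.le_preimage x ∈ (R'.strictTransformPlus i.ker).ideal 𝒞.W' → x * β ∈ i.ker.ideal (𝒜.W a)) →
      (R'.strictTransformPlus i.ker).subschemeι ⁻¹ᵁ (𝒞.W' : (R'.plus : Scheme.{0}).Opens) = q' ⁻¹ᵁ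
      blowupChart ρ (((((D.centre f i.ker).piece Dg).comap i).subschemeι ≫ q).ker) (𝒜.U a) b ∧ ρ.appLE
      (𝒜.U a) (blowupChart ρ (((((D.centre f i.ker).piece Dg).comap i).subschemeι ≫ q).ker) (𝒜.U a) b)
      (blowupChart_le_preimage ρ (((((D.centre f i.ker).piece Dg).comap i).subschemeι ≫ q).ker) (𝒜.U
      a) b) b ∈ nonZeroDivisors Γ(V', blowupChart ρ (((((D.centre f i.ker).piece Dg).comap
      i).subschemeι ≫ q).ker) (𝒜.U a) b) ∧ (∀ c' : Γ(V', blowupChart ρ (((((D.centre f i.ker).piece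
      Dg).comap i).subschemeι ≫ q).ker) (𝒜.U a) b), ∃ (l : ℕ) (c : Γ(V, 𝒜.U a)), c ∈ (((((D.centre f
      i.ker).piece Dg).comap i).subschemeι ≫ q).ker).ideal (𝒜.U a) ^ l ∧ c' * ρ.appLE (𝒜.U a)
      (blowupChart ρ (((((D.centre f i.ker).piece Dg).comap i).subschemeι ≫ q).ker) (𝒜.U a) b)
      (blowupChart_le_preimage ρ (((((D.centre f i.ker).piece Dg).comap i).subschemeι ≫ q).ker) (𝒜.U
      a) b) b ^ l = ρ.appLE (𝒜.U a) (blowupChart ρ (((((D.centre f i.ker).piece Dg).comap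
      i).subschemeι ≫ q).ker) (𝒜.U a) b) (blowupChart_le_preimage ρ (((((D.centre f i.ker).piece
      Dg).comap i).subschemeι ≫ q).ker) (𝒜.U a) b) c) ∧ (∀ (l : ℕ) (c : Γ(V, 𝒜.U a)), c ∈
      (((((D.centre f i.ker).piece Dg).comap i).subschemeι ≫ q).ker).ideal (𝒜.U a) ^ l → ∃ c' : Γ(V',
      blowupChart ρ (((((D.centre f i.ker).piece Dg).comap i).subschemeι ≫ q).ker) (𝒜.U a) b), c' *
      ρ.appLE (𝒜.U a) (blowupChart ρ (((((D.centre f i.ker).piece Dg).comap i).subschemeι ≫ q).ker)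
      (𝒜.U a) b) (blowupChart_le_preimage ρ (((((D.centre f i.ker).piece Dg).comap i).subschemeι ≫
      q).ker) (𝒜.U a) b) b ^ l = ρ.appLE (𝒜.U a) (blowupChart ρ (((((D.centre f i.ker).piece Dg).comap
      i).subschemeι ≫ q).ker) (𝒜.U a) b) (blowupChart_le_preimage ρ (((((D.centre f i.ker).piece
      Dg).comap i).subschemeι ≫ q).ker) (𝒜.U a) b) c) ∧ Function.Injective (q'.app (blowupChart ρ
      (((((D.centre f i.ker).piece Dg).comap i).subschemeι ≫ q).ker) (𝒜.U a) b)) := by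
  intro p D k _ _ _ Y X V f _ _ _ i _ _ q _ _ _ _ _ _ j 𝒜 hguard R' hR' _ σX hσX Dg _ hexc hA3
    V' ρ hρ _ q' hq' a b hb β hβJ hβ 𝒞 hcontr
  have hτ := Lift.nonempty_preimage_basicOpen D f i hguard R' hR'
  have hQ1 := preimage_W'_eq f i q 𝒜 (D.centre f i.ker).piece R' σX hσX Dg _ ρ q' hq' a hτ hA3
    hρ hexc hb hβJ hβ 𝒞
  exact ⟨hQ1, appLE_blowupChart_mem_nonZeroDivisors hρ hb,
    fun c' => exists_of_section_blowupChart hρ hb c',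
    fun l c hc => exists_section_blowupChart hρ hb hc,
    app_blowupChart_injective f i q 𝒜 _ R' σX hσX Dg _ ρ hρ q' hq' a hb hβ 𝒞 hcontr hQ1⟩

end Summit.ResolutionOfSingularities.ResolutionOfSingularities.Theorems.DatumToEmbedded.AtlasQuotient

end
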